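import Summits.ResolutionOfSingularities.ResolutionOfSingularities.Theorems.EquisingularLiftEquisingularLiftNatNDRoundModel
import Summits.ResolutionOfSingularities.ResolutionOfSingularities.Theorems.EquisingularLiftEquisingularLiftNatNDFanStarBasics
import Mathlib.RingTheory.Ideal.KrullsHeightTheorem
import HarnessLib

/-!
# [OURS · L1 W4.5(b) · EL♮(3)] (B4α1s) FRAME HELPERS — `…NatNDModelStepFrame`: every conjunct of `ModelStep`'s conclusion EXCEPT the (TS1) chart clause,
# as `ToricStage`-free lemmas (desk APPROVAL 2026-08-28T14:58:32Z as SUPPORT under res-L1-w45b-stub-4's (B4α1s) row; stub-4's SHAPE ASKS 14:58:53Z (a)–(d))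

OURS · L1 W4.5(b) · EL♮(3) stmt-ResolutionOfSingularities-20148 (parent EL♮ stmt-…-20038) · counted 0 · AI-written (res-L1-w45b-iso-w1 g0, WIDTH seat on
D-0157 DOOR 1), weaker than expert review; nothing of [Hironaka2017] asserted; no statement of the manuscript; dim-3 char-p resolution is CP 2008/2009 in
print — this is a piece of OUR kernel-own version.  Sorry-free, def-free, standard axioms, no instance, no notation.  Every field `k`, every `n`
(no `IsAlgClosed` needed here).  `--supports stmt-ResolutionOfSingularities-20148 --as helper`: support toward the registered 4th CHILD stub
`stub_elnat_three_isolated_newtonNondegenerate` through (B4α1s) `modelStep` (res-L1-w45b-stub-4 assembles it BY NAME over the text owner's port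
`…NatNDRoundModelSplit`; one writer per brick) → `modelRound` → `roundAtNDFrame` → `nd_rung_local`.

WHAT IS PROVED (names as stub-4 will call them; `φ : F ⟶ Aff n k` a GENERAL base map, so `φ = 𝟙 _`, `C = 𝓘{0}`, `υ = π₀` is the `ModelInit` instance):
* (L0) `isSmoothCone_of_mem_star` — all cones of `star Φ τ` are smooth if all cones of `Φ` are; ray facts (`ray_nonneg_of_isSmoothCone`,
  `ray_ne_zero_of_isSmoothCone` are res-L1-w45b-iso-w3's, `…NatNDFanStarBasics`, imported) `two_le_of_exists_notMem_range_e` (a non-frame ray in a smooth cone forces `n ≥ 2`), `sum_notMem_range_e` (the created ray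
  `Σ_{ρ∈τ} ρ` is never a frame ray when `τ ⊆` a smooth cone has a non-frame ray).
* (L1) `support_stratum_subset_of_charts` — LEGALITY `hE1`: `supp (stratum E τ) ⊆ T` for every `Bad (table g) τ`, from the (TS1) chart clause VERBATIM
  (chart-map family `ψ`, instantiate `ψ := toricChartHom n k`); with `mem_of_forall_support_exists_X_mem`.
* (L2) `not_subset_support_stratum` — LEGALITY `hT`: `¬ T ⊆ supp (stratum E τ)` for `τ ⊆ σ₀ ∈ Φ` with a non-frame ray, from (TS0) smooth cones, (TS2)
  `IsIso (φ ∣_ {0}ᶜ)`, (TS3) bookkeeping, (TS5) non-frame members over the origin, `LocalND g`; via `exists_mem_zeroLocus_ne_affOrigin` (a hypersurface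
  through the origin of `𝔸ⁿ`, `n ≥ 2`, has a scheme point `≠ 0`: Krull's Hauptidealsatz vs `height_originIdeal = n`).
* (L3) `isIso_comp_morphismRestrict_compl_affOrigin` — `IsIso ((υ ≫ φ) ∣_ {0}ᶜ)` from `IsIso (φ ∣_ {0}ᶜ)`, `IsBlowup υ C`, `supp C ⊆ φ⁻¹{0}` (GW 13.91 (3)).
* (L4) `closure_preimage_diff_inter_compl_eq` — bookkeeping `closure (υ⁻¹(T ∖ supp C)) ∩ (υ≫φ)⁻¹{0}ᶜ = (υ≫φ)⁻¹(V(g) ∖ 0)`.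
* (L5) `support_stratum_subset`, `support_stratum_subset_preimage`, `support_comap_subset_preimage`, `support_strictTransformIdeal_subset_preimage`,
  `support_stepAlong_subset_preimage` — strata with a non-frame ray, exceptional members and strict transforms of members over the origin lie over the origin;
  after the star every NON-FRAME member of `E.stepAlong (stratum E τ) (Στ) υ` lies over the origin.
-/

set_option linter.dupNamespace false

noncomputable section

open CategoryTheory CategoryTheory.Limits AlgebraicGeometry TopologicalSpace Topology
open MvPolynomial IsLocalRing
open Literature.AlgebraicGeometry.Resolution
open AlgebraicGeometry.Scheme.IdealSheafData

namespace Summit.ResolutionOfSingularities.ResolutionOfSingularities.Cruxes.EquisingularLiftNat.Sections.ND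

open Summit.ResolutionOfSingularities.ResolutionOfSingularities.Cruxes.EquisingularLiftNat.Sections

section Frame

variable {n : ℕ} {k : Type} [Field k]

/-! ### (L0) smoothness of the starred position; ray facts -/

/-- **(L0)** If every maximal cone of `Φ` is smooth with natural rays, so is every maximal cone of `star Φ τ` (for any face `τ`): untouched cones are old
cones, new cones are `isSmoothCone_starCone`.  [OURS] -/
theorem isSmoothCone_of_mem_star {Φ : Finset (Finset (Ray n))} (hΦ : ∀ σ ∈ Φ, IsSmoothCone σ) (τ : Finset (Ray n)) :
    ∀ γ ∈ star Φ τ, IsSmoothCone γ := by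
  classical
  intro γ hγ
  simp only [Summit.ResolutionOfSingularities.ResolutionOfSingularities.Cruxes.EquisingularLiftNat.Sections.star, Finset.mem_union,
    Finset.mem_filter, Finset.mem_biUnion, Finset.mem_image] at hγ
  rcases hγ with ⟨hγF, -⟩ | ⟨σ₁, ⟨hσ₁F, hτσ₁⟩, t, ht, rfl⟩
  · exact hΦ γ hγF
  · exact isSmoothCone_starCone (hΦ σ₁ hσ₁F) hτσ₁ ht

/-- **A face with a non-frame ray inside a smooth cone forces `n ≥ 2`** (for `n ≤ 1` the only smooth natural cone is the frame itself). [OURS] -/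
theorem two_le_of_exists_notMem_range_e {σ τ : Finset (Ray n)} (hσ : IsSmoothCone σ) (hτσ : τ ⊆ σ)
    (hτ : ∃ ρ ∈ τ, ρ ∉ Set.range (e n)) : 2 ≤ n := by
  by_contra hlt
  rw [not_le] at hlt
  obtain ⟨ρ, hρτ, hρe⟩ := hτ
  obtain ⟨B, rfl, hdet⟩ := hσ
  obtain ⟨i, -, rfl⟩ := Finset.mem_image.1 (hτσ hρτ)
  interval_cases n
  · exact i.elim0
  · apply hρe
    obtain rfl : i = 0 := Subsingleton.elim _ _
    refine ⟨0, ?_⟩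
    have hd : (zMat B).det = (B 0 0 : ℤ) := by rw [Matrix.det_fin_one]; rfl
    have h1 : B 0 0 = 1 := by
      rcases Int.isUnit_iff.1 hdet with h | h <;> rw [hd] at h <;> omega
    funext l
    obtain rfl : l = 0 := Subsingleton.elim _ _
    simp [e, rayOf, h1]

/-- **The created ray `Σ_{ρ∈τ} ρ` is not a frame ray** when `τ` lies in a smooth cone and contains a non-frame ray (all rays are non-negative and non-zero,
so `Στ ≥ ρ₀` coordinatewise forces `ρ₀ ≤ e_j`, i.e. `ρ₀ ∈ {0, e_j}`).  [OURS] -/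
theorem sum_notMem_range_e {σ τ : Finset (Ray n)} (hσ : IsSmoothCone σ) (hτσ : τ ⊆ σ)
    (hτ : ∃ ρ ∈ τ, ρ ∉ Set.range (e n)) : (∑ ρ ∈ τ, ρ) ∉ Set.range (e n) := by
  rintro ⟨j, hj⟩
  obtain ⟨ρ₀, hρ₀, hρ₀e⟩ := hτ
  have hnn : ∀ ρ ∈ τ, ∀ l, 0 ≤ ρ l := fun ρ hρ l => ray_nonneg_of_isSmoothCone hσ (hτσ hρ) l
  have hle : ∀ l, ρ₀ l ≤ e n j l := fun l => by
    rw [hj, Finset.sum_apply]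
    exact Finset.single_le_sum (f := fun ρ => ρ l) (fun ρ hρ => hnn ρ hρ l) hρ₀
  by_cases h0 : ρ₀ j = 0
  · apply ray_ne_zero_of_isSmoothCone hσ (hτσ hρ₀)
    funext l
    by_cases hl : l = j
    · rw [hl]; exact h0
    · have := hle l
      simp only [e, Pi.single_apply, hl, if_false] at this
      exact le_antisymm this (hnn ρ₀ hρ₀ l)
  · apply hρ₀e
    refine ⟨j, ?_⟩
    funext l
    by_cases hl : l = j
    · subst hl
      have h1 := hle l
      simp only [e, Pi.single_apply, if_true] at h1
      have h2 := hnn ρ₀ hρ₀ l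
      simp only [e, Pi.single_apply, if_true]
      omega
    · have := hle l
      simp only [e, Pi.single_apply, hl, if_false] at this
      simp only [e, Pi.single_apply, hl, if_false]
      exact le_antisymm (hnn ρ₀ hρ₀ l) this

/-! ### Supports of strata and of stepped boundaries -/

/-- The stratum of a face lies inside every member of the face: `supp (τ.sup E) ⊆ supp (E ρ)` for `ρ ∈ τ`. [OURS] -/
theorem support_stratum_subset {F : Scheme.{0}} (E : Boundary n F) {τ : Finset (Ray n)} {ρ : Ray n} (hρ : ρ ∈ τ) :
    ((stratum E τ).support : Set F) ⊆ (E ρ).support :=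
  Scheme.IdealSheafData.support_antitone (Finset.le_sup (f := E) hρ)

/-- A stratum with a NON-FRAME ray lies over the origin, if all non-frame members do. [OURS] -/
theorem support_stratum_subset_preimage {F : Scheme.{0}} (φ : F ⟶ Aff n k) (E : Boundary n F) {τ : Finset (Ray n)}
    (hτ : ∃ ρ ∈ τ, ρ ∉ Set.range (e n)) (hE : ∀ ρ, ρ ∉ Set.range (e n) → ((E ρ).support : Set F) ⊆ φ ⁻¹' {affOrigin n k}) :
    ((stratum E τ).support : Set F) ⊆ φ ⁻¹' {affOrigin n k} := by
  obtain ⟨ρ₀, hρ₀, hρ₀e⟩ := hτ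
  exact (support_stratum_subset E hρ₀).trans (hE ρ₀ hρ₀e)

/-- **(L5a)** The exceptional member after blowing up a centre over the origin lies over the origin: `supp (C·𝒪_{F'}) = υ⁻¹ supp C`. [OURS] -/
theorem support_comap_subset_preimage {F F' : Scheme.{0}} (φ : F ⟶ Aff n k) (C : F.IdealSheafData)
    (hC : (C.support : Set F) ⊆ φ ⁻¹' {affOrigin n k}) (υ : F' ⟶ F) :
    ((C.comap υ).support : Set F') ⊆ (υ ≫ φ) ⁻¹' {affOrigin n k} := by
  rw [Scheme.IdealSheafData.support_comap, Closeds.coe_preimage]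
  intro x hx
  rw [Set.mem_preimage, Scheme.Hom.comp_apply]
  exact hC hx

/-- **(L5b)** The strict transform of a member over the origin lies over the origin (it contains the total transform). [OURS] -/
theorem support_strictTransformIdeal_subset_preimage {F F' : Scheme.{0}} (φ : F ⟶ Aff n k) (C K : F.IdealSheafData)
    (hK : (K.support : Set F) ⊆ φ ⁻¹' {affOrigin n k}) (υ : F' ⟶ F) :
    ((strictTransformIdeal υ C K).support : Set F') ⊆ (υ ≫ φ) ⁻¹' {affOrigin n k} := by
  have hle : K.comap υ ≤ strictTransformIdeal υ C K :=
    (comap_le_controlledTransform υ C K 1).trans (controlledTransform_le_strictTransformIdeal υ C K 1)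
  intro x hx
  exact support_comap_subset_preimage φ K hK υ (Scheme.IdealSheafData.support_antitone hle hx)

/-- **(L5)** After the star at a face `τ` with a non-frame ray, every NON-FRAME member of the stepped boundary lies over the origin (given that the old
non-frame members do).  [OURS] -/
theorem support_stepAlong_subset_preimage {F F' : Scheme.{0}} (φ : F ⟶ Aff n k) (E : Boundary n F) (τ : Finset (Ray n))
    (hτ : ∃ ρ ∈ τ, ρ ∉ Set.range (e n)) (hE : ∀ ρ, ρ ∉ Set.range (e n) → ((E ρ).support : Set F) ⊆ φ ⁻¹' {affOrigin n k})
    (υ : F' ⟶ F) :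
    ∀ ρ, ρ ∉ Set.range (e n) →
      (((E.stepAlong (stratum E τ) (∑ ρ ∈ τ, ρ) υ) ρ).support : Set F') ⊆ (υ ≫ φ) ⁻¹' {affOrigin n k} := by
  intro ρ hρ
  have hC := support_stratum_subset_preimage φ E hτ hE
  by_cases h : ρ = ∑ ρ ∈ τ, ρ
  · rw [h, stepAlong_self]
    exact support_comap_subset_preimage φ _ hC υ
  · rw [stepAlong_of_ne E _ h υ]
    exact support_strictTransformIdeal_subset_preimage φ _ _ (hE ρ hρ) υ

/-! ### (L3) isomorphy off the origin and (L4) exact bookkeeping survive a blow-up of a centre over the origin -/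

/-- **(L3)** `υ ≫ φ` is an isomorphism off the origin if `φ` is and `υ` is a blow-up of a centre lying over the origin (GW 13.91 (3)). [OURS] -/
theorem isIso_comp_morphismRestrict_compl_affOrigin {F F' : Scheme.{0}} (φ : F ⟶ Aff n k)
    (hφ : IsIso (φ ∣_ (⟨{affOrigin n k}ᶜ, (isClosed_affOrigin n k).isOpen_compl⟩ : (Aff n k).Opens)))
    (C : F.IdealSheafData) (hC : (C.support : Set F) ⊆ φ ⁻¹' {affOrigin n k}) (υ : F' ⟶ F) (hυ : IsBlowup υ C) :
    IsIso ((υ ≫ φ) ∣_ (⟨{affOrigin n k}ᶜ, (isClosed_affOrigin n k).isOpen_compl⟩ : (Aff n k).Opens)) := by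
  rw [morphismRestrict_comp]
  have h1 : IsIso (υ ∣_ φ ⁻¹ᵁ (⟨{affOrigin n k}ᶜ, (isClosed_affOrigin n k).isOpen_compl⟩ : (Aff n k).Opens)) :=
    hυ.isIso_morphismRestrict (Set.disjoint_left.mpr fun x hx hxC => hx (hC hxC))
  exact @IsIso.comp_isIso _ _ _ _ _ _ _ h1 hφ

/-- **(L4)** Exact bookkeeping off the origin survives the step: `closure (υ⁻¹(T ∖ supp C)) ∩ (υ≫φ)⁻¹{0}ᶜ = (υ≫φ)⁻¹(V(g) ∖ 0)` when `T` is closed,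
`T ∩ φ⁻¹{0}ᶜ = φ⁻¹(V(g) ∖ 0)` and `supp C ⊆ φ⁻¹{0}`.  [OURS] -/
theorem closure_preimage_diff_inter_compl_eq {F F' : Scheme.{0}} (φ : F ⟶ Aff n k) (g : MvPolynomial (Fin n) k) (T : Set F)
    (hT : IsClosed T) (hbook : T ∩ φ ⁻¹' {affOrigin n k}ᶜ = φ ⁻¹' (PrimeSpectrum.zeroLocus {g} \ {affOrigin n k}))
    (C : F.IdealSheafData) (hC : (C.support : Set F) ⊆ φ ⁻¹' {affOrigin n k}) (υ : F' ⟶ F) :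
    closure (υ ⁻¹' (T \ (C.support : Set F))) ∩ (υ ≫ φ) ⁻¹' {affOrigin n k}ᶜ =
      (υ ≫ φ) ⁻¹' (PrimeSpectrum.zeroLocus {g} \ {affOrigin n k}) := by
  have hcomp : ∀ S : Set (Aff n k), (υ ≫ φ) ⁻¹' S = υ ⁻¹' (φ ⁻¹' S) := fun S => by
    ext x; simp only [Set.mem_preimage, Scheme.Hom.comp_apply]
  rw [hcomp, hcomp, ← hbook, Set.preimage_inter]
  apply le_antisymm
  · rintro x ⟨hx1, hx2⟩
    refine ⟨?_, hx2⟩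
    exact (closure_minimal (Set.preimage_mono fun y hy => hy.1) (hT.preimage υ.continuous)) hx1
  · rintro x ⟨hx1, hx2⟩
    refine ⟨subset_closure ⟨hx1, fun hxC => hx2 (hC hxC)⟩, hx2⟩

/-! ### (L2) the strict transform is not swallowed by a stratum over the origin -/

/-- The ideal of the origin of `𝔸ⁿ_k` has height `n`. [OURS · folklore] -/
theorem height_originIdeal : (originIdeal k n).height = n := by
  have h := IsLocalization.AtPrime.ringKrullDim_eq_height (originIdeal k n) (OriginLocalization k n)
  rw [ringKrullDim_originLocalization] at h
  exact_mod_cast h.symm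

/-- **A hypersurface through the origin of `𝔸ⁿ`, `n ≥ 2`, has a scheme point other than the origin** (a minimal prime over `(g)` has height `≤ 1` by
Krull's Hauptidealsatz, the origin has height `n ≥ 2`).  Every field `k`.  [OURS · folklore] -/
theorem exists_mem_zeroLocus_ne_affOrigin (hn : 2 ≤ n) (g : MvPolynomial (Fin n) k) (hg0 : constantCoeff g = 0) :
    ∃ P : Aff n k, P ∈ PrimeSpectrum.zeroLocus {g} ∧ P ≠ affOrigin n k := by
  have hle : Ideal.span {g} ≤ originIdeal k n := by
    rw [Ideal.span_le, Set.singleton_subset_iff]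
    exact (mem_originIdeal_iff k n).mpr hg0
  obtain ⟨p, hp, -⟩ := Ideal.exists_minimalPrimes_le hle
  haveI : p.IsPrime := hp.1.1
  refine ⟨⟨p, hp.1.1⟩, ?_, fun h => ?_⟩
  · change {g} ⊆ (p : Set (MvPolynomial (Fin n) k))
    rw [Set.singleton_subset_iff]
    exact hp.1.2 (Ideal.subset_span rfl)
  · have h1 : p.height ≤ 1 := Ideal.height_le_one_of_isPrincipal_of_mem_minimalPrimes (Ideal.span {g}) p hp
    have h2 : p = originIdeal k n := congrArg PrimeSpectrum.asIdeal h
    rw [h2, height_originIdeal] at h1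
    have : (n : ℕ∞) ≤ 1 := h1
    have : n ≤ 1 := by exact_mod_cast this
    omega

/-- **(L2)** At a toric stage, the strict transform `T` is NOT contained in the stratum of a face `τ ⊆ σ₀ ∈ Φ` with a non-frame ray: the stratum lies
over the origin, whereas `T ⊇ φ⁻¹(V(g) ∖ 0) ≠ ∅` (`n ≥ 2` is forced by the non-frame ray; `φ` is onto off the origin).  [OURS] -/
theorem not_subset_support_stratum {F : Scheme.{0}} (g : MvPolynomial (Fin n) k) (hg : LocalND g)
    {Φ : Finset (Finset (Ray n))} (hΦ : ∀ σ ∈ Φ, IsSmoothCone σ) (φ : F ⟶ Aff n k) (E : Boundary n F) (T : Set F)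
    (hiso : IsIso (φ ∣_ (⟨{affOrigin n k}ᶜ, (isClosed_affOrigin n k).isOpen_compl⟩ : (Aff n k).Opens)))
    (hbook : T ∩ φ ⁻¹' {affOrigin n k}ᶜ = φ ⁻¹' (PrimeSpectrum.zeroLocus {g} \ {affOrigin n k}))
    (hE : ∀ ρ, ρ ∉ Set.range (e n) → ((E ρ).support : Set F) ⊆ φ ⁻¹' {affOrigin n k})
    {σ₀ τ : Finset (Ray n)} (hσ₀ : σ₀ ∈ Φ) (hτσ : τ ⊆ σ₀) (hτ : ∃ ρ ∈ τ, ρ ∉ Set.range (e n)) :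
    ¬ T ⊆ ((stratum E τ).support : Set F) := by
  intro hT
  have hn : 2 ≤ n := two_le_of_exists_notMem_range_e (hΦ σ₀ hσ₀) hτσ hτ
  obtain ⟨P, hPg, hP0⟩ := exists_mem_zeroLocus_ne_affOrigin hn g hg.1.1
  -- a point of `F` over `P` (φ is onto off the origin)
  set U : (Aff n k).Opens := ⟨{affOrigin n k}ᶜ, (isClosed_affOrigin n k).isOpen_compl⟩ with hU
  haveI := hiso
  obtain ⟨x', hx'⟩ := (φ ∣_ U).homeomorph.surjective ⟨P, hP0⟩
  have hφx : φ x'.1 = P := by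
    have := congrArg Subtype.val hx'
    rw [Scheme.Hom.homeomorph_apply, morphismRestrict_base_coe] at this
    exact this
  have hxT : (x'.1 : F) ∈ T := by
    have : (x'.1 : F) ∈ T ∩ φ ⁻¹' {affOrigin n k}ᶜ := by
      rw [hbook]
      refine ⟨?_, ?_⟩
      · show φ x'.1 ∈ PrimeSpectrum.zeroLocus {g}
        rw [hφx]; exact hPg
      · show φ x'.1 ∉ ({affOrigin n k} : Set (Aff n k))
        rw [hφx, Set.mem_singleton_iff]; exact hP0
    exact this.1
  have hx0 : φ x'.1 = affOrigin n k := support_stratum_subset_preimage φ E hτ hE (hT hxT)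
  exact hP0 (hφx ▸ hx0)


/-! ### (L1) legality `hE1`: the stratum of a `Bad` face lies inside the strict transform, chart by chart -/

/-- Every monomial of `G` involves a variable from `I`, and these variables lie in the prime `𝔭` ⟹ `G ∈ 𝔭`. [OURS] -/
theorem mem_of_forall_support_exists_X_mem {G : MvPolynomial (Fin n) k} {I : Finset (Fin n)} {p : Ideal (MvPolynomial (Fin n) k)}
    (hmon : ∀ d ∈ G.support, ∃ i ∈ I, d i ≠ 0) (hX : ∀ i ∈ I, (X i : MvPolynomial (Fin n) k) ∈ p) : G ∈ p := by
  classical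
  rw [G.as_sum]
  refine Ideal.sum_mem _ fun d hd => ?_
  obtain ⟨i, hi, hdi⟩ := hmon d hd
  obtain ⟨q, hq⟩ := (X_dvd_monomial (i := i) (j := d) (r := coeff d G)).2 (Or.inr hdi)
  rw [hq]
  exact Ideal.mul_mem_right _ _ (hX i hi)

/-- **(L1) LEGALITY `hE1` from the chart data (TS1).**  If every point of `F` has a toric chart `c : 𝔸ⁿ_k ⟶ F` of a cone `σ ∈ Φ` in which the members of
the rays of `σ` are the coordinate hyperplanes, the other members are absent, and `T` is `V(toricStrict B g)`, then the stratum of every `Bad` face `τ`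
lies inside `T`: at a point of the stratum the chart cone contains `τ` (absent members have empty support), `τ = τ_I`, the coordinates `yᵢ`, `i ∈ I`, vanish
there, and every monomial of `toricStrict B g` carries such a coordinate (`toricStrict_vanishes_of_bad`).  The chart map family `ψ` (meant: `toricChartHom n k`)
and `φ` are not used — they are carried so that the hypothesis is the (TS1) clause of `ToricStage` verbatim.  [OURS] -/
theorem support_stratum_subset_of_charts (g : MvPolynomial (Fin n) k) (Φ : Finset (Finset (Ray n))) {F : Scheme.{0}} (φ : F ⟶ Aff n k)
    (E : Boundary n F) (T : Set F) (ψ : (Fin n → Fin n → ℕ) → (MvPolynomial (Fin n) k →+* MvPolynomial (Fin n) k))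
    (h1 : ∀ x : F, ∃ σ ∈ Φ, ∃ (B : Fin n → Fin n → ℕ) (c : Aff n k ⟶ F), IsOpenImmersion c ∧ x ∈ Set.range c.base ∧
      σ = Finset.univ.image (fun i => rayOf (B i)) ∧ IsUnit (zMat B).det ∧
      c ≫ φ = Spec.map (CommRingCat.ofHom (ψ B)) ∧
      (∀ i, (E (rayOf (B i))).comap c = coordHyperplane n k i) ∧
      (∀ ρ, ρ ∉ σ → (E ρ).comap c = ⊤) ∧
      c ⁻¹' T = PrimeSpectrum.zeroLocus {toricStrict B g})
    {τ : Finset (Ray n)} (hbad : Bad (table g) τ) :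
    ((stratum E τ).support : Set F) ⊆ T := by
  classical
  intro x hx
  obtain ⟨σ, -, B, c, -, ⟨y, rfl⟩, hσB, -, -, hEc, hEtop, hcT⟩ := h1 x
  have hmem : ∀ ρ ∈ τ, c.base y ∈ ((E ρ).support : Set F) := fun ρ hρ => support_stratum_subset E hρ hx
  -- every ray of `τ` is a ray of the chart cone
  have hτσ : τ ⊆ σ := by
    intro ρ hρ
    by_contra hρσ
    have hy : y ∈ (((E ρ).comap c).support : Set (Aff n k)) := by
      rw [Scheme.IdealSheafData.support_comap, Closeds.coe_preimage]
      exact hmem ρ hρ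
    rw [hEtop ρ hρσ, Scheme.IdealSheafData.support_top] at hy
    exact hy
  -- `τ = τ_I`
  set I : Finset (Fin n) := Finset.univ.filter (fun i => rayOf (B i) ∈ τ) with hI
  have hτI : τ = I.image (fun i => rayOf (B i)) := by
    ext ρ
    constructor
    · intro hρ
      have hρσ := hτσ hρ
      rw [hσB] at hρσ
      obtain ⟨i, -, rfl⟩ := Finset.mem_image.1 hρσ
      exact Finset.mem_image_of_mem _ (Finset.mem_filter.2 ⟨Finset.mem_univ _, hρ⟩)
    · intro hρ
      obtain ⟨i, hi, rfl⟩ := Finset.mem_image.1 hρ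
      exact (Finset.mem_filter.1 hi).2
  -- the coordinates of `I` vanish at `y`
  have hXy : ∀ i ∈ I, (X i : MvPolynomial (Fin n) k) ∈ y.asIdeal := by
    intro i hi
    have hρ : rayOf (B i) ∈ τ := (Finset.mem_filter.1 hi).2
    have hy : y ∈ (((E (rayOf (B i))).comap c).support : Set (Aff n k)) := by
      rw [Scheme.IdealSheafData.support_comap, Closeds.coe_preimage]
      exact hmem _ hρ
    rw [hEc i] at hy
    have hy' : y ∈ PrimeSpectrum.zeroLocus {(X i : MvPolynomial (Fin n) k)} := by
      unfold coordHyperplane at hy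
      rw [coe_support_vanishingIdeal] at hy
      exact hy
    exact hy' (Set.mem_singleton _)
  -- hence `toricStrict B g ∈ 𝔭_y`, i.e. `c y ∈ T`
  have hG : toricStrict B g ∈ y.asIdeal :=
    mem_of_forall_support_exists_X_mem (toricStrict_vanishes_of_bad B g I (hτI ▸ hbad)) hXy
  have hyT : y ∈ c ⁻¹' T := by
    rw [hcT]
    intro f hf
    rw [Set.mem_singleton_iff] at hf
    rw [hf]
    exact hG
  exact hyT

end Frame

end Summit.ResolutionOfSingularities.ResolutionOfSingularities.Cruxes.EquisingularLiftNat.Sections.ND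

end
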